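import Summits.QuantumFields.YangMills.Theorems.VirialFluxGapRingDeficitDefs
import Literature.MathematicalPhysics.QuantumFieldTheory.LatticeGaugeStaticPotentialProofs
import HarnessLib

/-!
# Route `SwapVirialDeficit` (YangMills): the ACTION DEFICIT of a `2L`-slice ring history glued through the axis swap `σ` — definitions

Problem-side definitions for the fixed-`L` floor ∕ ceiling programme of the swap-twisted zero-flux trace `TT.twistTrace L β (2L)` (LEAD ym-line-sfw-p2
g93, 2026-08-31, bricks (α)∕(β); item stmt-QuantumFields-24197 `SwapVirialDeficit.SwapGluedStiffness`), the σ-twins of ✓`RingDeficit.ringExponent` ∕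
✓`RingDeficit.ringDeficit` (✓`VirialFluxGapRingDeficitDefs`):

* `swapRingExponent L z p` — the exponent `Ψ^S_z` of the σ-glued sector term: `log` of the chain of transfer kernels at coupling `1` closed through the
  seam bond `K(U_{2L−1}, g · tw_z(σU_0))`, `σ = configPerm (Equiv.swap 0 1)` (so that `Z^S(b) = (1/8) Σ_z ∫ exp(b·Ψ^S_z) d(ringMeasure L)`,
  ✓`SectorSmooth.twistTraceSucc_eq_sum_integral_prod` + ✓`swapSeamChain_eq_exp`);
* `swapRingDeficit L z p := 12L⁴ − Ψ^S_z(p)` — the σ-GLUED ACTION DEFICIT (`≥ 0`, zero exactly on σ-twisted flat histories).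

HONEST FRAMING: definitions only (no theorem, no `sorry`); nothing about ⟨24197⟩ ∕ ⟨24194⟩ or any rung is proved; the Yang–Mills mass gap is NOT proved;
no summit is proved by a line.  Width seat ym-line-sfw-p2-w3 g61 (cell ym-idea-1, free hands).  References: [cite: tHooft1979]; [cite: MontvayMunster1994, (3.145)];
[cite: Luscher1983, §2].
-/

set_option autoImplicit false

noncomputable section

open MeasureTheory
open scoped BigOperators
open Literature.MathematicalPhysics.QuantumFieldTheory hiding SU2
open Summit.QuantumFields.YangMills.Theorems.FemtoTransferGap

namespace Summit.QuantumFields.YangMills.Theorems.SwapVirialDeficit.SwapRing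

/-- The exponent `Ψ^S_z` of the σ-glued sector term: log of the chain of transfer kernels at coupling `1`, closed through the seam bond
`K(U_{2L−1}, g · tw_z(σ U_0))` with the spatial axes `0, 1` exchanged on the seam slice. [cite: tHooft1979] -/
def swapRingExponent (L : ℕ) [NeZero L] (z : Fin 3 → Bool)
    (p : (Fin (2 * L - 1 + 1) → GaugeConfig 3 L SU2) × (Site 3 L → SU2)) : ℝ :=
  Real.log ((∏ i : Fin (2 * L - 1), transferKernel su2Rep 1 (p.1 i.castSucc) (p.1 i.succ)) *
    transferKernel su2Rep 1 (p.1 (Fin.last (2 * L - 1)))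
      (gaugeTransform p.2 (TT.twist3 z (configPerm (Equiv.swap (0 : Fin 3) 1) (p.1 0)))))

/-- The σ-GLUED ACTION DEFICIT `F^S_z = 12L⁴ − Ψ^S_z` of a ring history (zero exactly on σ-twisted flat histories). [cite: Luscher1983, §2] -/
def swapRingDeficit (L : ℕ) [NeZero L] (z : Fin 3 → Bool)
    (p : (Fin (2 * L - 1 + 1) → GaugeConfig 3 L SU2) × (Site 3 L → SU2)) : ℝ :=
  12 * (L : ℝ) ^ 4 - swapRingExponent L z p

end Summit.QuantumFields.YangMills.Theorems.SwapVirialDeficit.SwapRing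

end
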